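import Literature.Probability.LatticeModels.DobrushinShlosmanStates
import HarnessLib

/-!
# Venture YMGap — track (c) «DS»: EXACTLY what a Dobrushin–Shlosman window (block) certificate
# must bound, and the PROVED door it feeds

HONEST FRAMING: venture file (cell `pub-ymgap`, QuantumFields programme), strong-coupling LATTICE
bookkeeping only (currency SC-a: exponential clustering of local observables of a lattice gauge
measure on a finite torus, constants uniform in the volume). It TYPES the hypothesis of a
Dobrushin–Shlosman finite-size ("window", "block") condition in the exact normalisation of the
tree's PROVED comparison theorem `Literature.Probability.LatticeModels.DobrushinShlosman.abs_covariance_le`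
(Dobrushin–Shlosman 1985 in the Vasserstein / Kantorovich–Rubinstein form, with covariance decay; no
printed hypothesis, any measurable spin space), bundles it as a `Certificate`, and re-exports the
door: certificate ⇒ covariance decay. NOTHING is certified or asserted here: no window system, no
array `k`, no value of `β` is claimed to satisfy the condition; no continuum, confinement or
mass-gap claim. The cell's numbers for the plaquette window of `SU(2)`, `d = 4` (zero exterior
field: received sum `γ₀(0) = (15 + 15β_W/4)·β_W/4`, `= 1` at `β_W ≈ 0.2509`; no certificate format
off zero field) live in the cell's `CLOSE-DS.md`, not in Lean.

## The dictionary (what a certificate must contain, field by field = `Certificate`)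

Cells `ι` (lattice gauge theory: the links of the torus `(ℤ/L)^d`, `cell = id`), a specification `γ`
(the torus weight specification `torusWeightSpec v` of a positive continuous plaquette weight `v`,
Wilson: `wilsonPlaqWeight N β`), and
* `w ≤ R` — a cell weight local in its cell (LGT: `r(σ_x, τ_x)` for a bounded weight `r` on the group,
  e.g. the Frobenius distance on `SU(2)`, `R = 2√2`);
* `Λ, win, N⋆` — the WINDOW SYSTEM: for every centre `c` a window cell set `win c ∋ c` with site set
  `Λ c` (LGT: `Λ = win`, e.g. the four links of a chosen plaquette through `c`; `{c}` = single-site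
  Dobrushin), `N⋆ ≥ #{c : x ∈ win c}`;
* `k ≥ 0` — the INFLUENCE ARRAY `k c y x` (centre `c`, boundary cell `y ∉ win c`, interior cell
  `x ∈ win c`) with **(H1)** `IsWindowKRContraction`: for ALL exterior conditions `ω, η` differing
  only on the cell `y` (common values elsewhere ARBITRARY — the whole exterior field space) and every
  bounded measurable window-local `f` with cell-Lipschitz vector `δ ≥ 0`,
  `|γ_{Λ c}(f | ω) − γ_{Λ c}(f | η)| ≤ (Σ_{x ∈ win c} k c y x · δ x) · w y ω η`;
* `γ₀ ∈ [0, 1)` with **(H2)** `IsDSReceivedSum`: `Σ_{c : x ∈ win c} Σ_y k c y x ≤ γ₀ · #{c : x ∈ win c}`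
  for every cell `x` — THE NUMBER a block computation has to certify.
OUTPUT (`Certificate.abs_covariance_le`): every Gibbs measure `ν` of `γ` has
`|cov_ν(f, g)| ≤ 4 R² e^{−κ₁ L₀} (Σ δ_f)(Σ δ_g)`, `κ₁ = Certificate.rate = (1 − γ₀)²/(2(2γ₀N⋆ + 1))`,
for any profile adapted to the window system and `≥ L₀` on the cells of `f`.

## Contents
* `IsWindowKRContraction`, `IsDSReceivedSum`, `Certificate`, `Certificate.rate(_pos)`,
  `Certificate.Obs` (admissible observables), `Certificate.Profile` (adapted profiles),
  `Certificate.abs_covariance_le` — general specification, finite cell type.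
* `Certificate.ofKRContraction` — SANITY (kernel-checked): the tree's single-site Dobrushin condition
  in the Vasserstein form (`DobrushinMetric.IsKRContraction γ r nbr C`, row sums `≤ c < 1`) IS the
  certificate of the window system `win x = {x}` (`N⋆ = 1`, `γ₀ = c`): the window door contains the
  single-site door (for `SU(2)`, `d = 4` the latter is the tree's front `β_W < 2/9`).
* The lattice-gauge dictionary (cells = links of `(ℤ/L)^d`, `torusWeightSpec v`, the `SU(N)` Wilson
  measure) is the sibling file `DSWindowCertificateLGT.lean`.

NOT here: any certificate instance (the cell found none beyond the single-site radius); the profile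
construction for a concrete window system (single-site: `exists_linkProfile`); the torus → `ℤ^d`
passage; the total-variation door (DS87 / complete analyticity: the tree's `pure_engine`, not a
small-block computable for `SU(2)`); disagreement percolation (van den Berg–Maes 1994 is printed for
FINITE spin spaces only, Ann. Probab. 22, p. 758 §3 item 4).

References (lineage; the door itself is the tree theorem): R. L. Dobrushin, S. B. Shlosman, in
*Statistical Physics and Dynamical Systems* (Birkhäuser 1985) 347–370 (condition `C_V`); J. Stat.
Phys. 46 (1987) 983–1014; D. W. Stroock, B. Zegarlinski, CMP 144 (1992) 303–323, Thm. 1.2, Rem.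
1.6–1.7; T. C. Dorlas, B. Savoie, arXiv:2305.19371, Thm. 5.1; H. Föllmer, LNM 1362 (1988) Ch. I Thm.
(2.13); H. Künsch, CMP 84 (1982); H.-O. Georgii (2011) §8.2; J. van den Berg, C. Maes, Ann. Probab.
22 (1994) 749–763.
-/

noncomputable section

open MeasureTheory ProbabilityTheory Function
open Literature.Probability.LatticeModels
open Literature.Probability.LatticeModels.DobrushinMetric (siteLaw siteAvg_eq_integral_siteLaw
  IsKRContraction)

namespace Summit.Ventures.YMGap.DSWindow

/-! ### The two hypotheses and the certificate, for a general specification read on cells -/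

section Abstract

variable {ι V S : Type*} [MeasurableSpace S]

/-- **(H1) Vector Kantorovich–Rubinstein contraction of the window kernels, one boundary cell at a
time.** For the specification `γ` on `V → S` read through `cell : V → ι`, cell weights `w`, window
site sets `Λ c` and window cell sets `win c`, the array `k c y x` bounds the influence of the
boundary cell `y ∉ win c` on the interior cell `x ∈ win c` THROUGH THE WINDOW KERNEL `γ_{Λ c}`:
for all exterior conditions `ω, η` agreeing off the cell `y` (their common values elsewhere are
arbitrary) and every bounded measurable `f` reading only the cells of `win c`, with nonnegative
cell-Lipschitz vector `δ` (`|f σ − f τ| ≤ δ x · w x σ τ` whenever `σ = τ` off the cell `x`),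
`|∫ f dγ_{Λ c}(· | ω) − ∫ f dγ_{Λ c}(· | η)| ≤ (Σ_{x ∈ win c} k c y x · δ x) · w y ω η`.
VERBATIM the hypothesis `hcontract` of the tree's `DobrushinShlosman.abs_covariance_le`
(Dobrushin–Shlosman 1985, condition `C_V`, in the Vasserstein form of Dorlas–Savoie Thm. 5.1, refined
to a per-interior-cell array). -/
def IsWindowKRContraction (γ : Specification V S) (cell : V → ι)
    (w : ι → (V → S) → (V → S) → ℝ) (Λ : ι → Finset V) (win : ι → Finset ι)
    (k : ι → ι → ι → ℝ) : Prop :=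
  ∀ (c y : ι), y ∉ win c → ∀ (ω η : V → S), (∀ v, cell v ≠ y → ω v = η v) →
    ∀ (f : (V → S) → ℝ) (δ : ι → ℝ), Measurable f → (∃ B, ∀ σ, |f σ| ≤ B) →
      DependsOn f {v | cell v ∈ win c} → (∀ x, 0 ≤ δ x) →
      (∀ (x : ι) (σ τ : V → S), (∀ v, cell v ≠ x → σ v = τ v) → |f σ - f τ| ≤ δ x * w x σ τ) →
        |∫ σ, f σ ∂(γ (Λ c) ω) - ∫ σ, f σ ∂(γ (Λ c) η)| ≤ (∑ x ∈ win c, k c y x * δ x) * w y ω η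

variable [Fintype ι] [DecidableEq ι]

/-- **(H2) The averaged received-sum condition** of Dobrushin–Shlosman with ratio `γ₀`: for every
cell `x`, the total influence received by `x` through all windows containing it is at most `γ₀`
times the number of such windows, `Σ_{c : x ∈ win c} Σ_y k c y x ≤ γ₀ · #{c : x ∈ win c}`.
VERBATIM the hypothesis `hsum` of `DobrushinShlosman.abs_covariance_le`; for translates
`win c = c + V₀` of one block it is Dobrushin–Shlosman's `C_V₀` ("total boundary influence
`< |V₀|`") in the Kantorovich–Rubinstein vector form. The certified value of `γ₀ < 1` is the
number a block computation has to deliver. -/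
def IsDSReceivedSum (win : ι → Finset ι) (k : ι → ι → ι → ℝ) (γ₀ : ℝ) : Prop :=
  ∀ x, ∑ c ∈ Finset.univ.filter (fun c => x ∈ win c), ∑ y, k c y x ≤
    γ₀ * (Finset.univ.filter fun c => x ∈ win c).card

/-- **A Dobrushin–Shlosman window certificate** for the specification `γ` read on the (finite) cell
type `ι` through `cell`: the data a certified block computation must supply — cell weight `w ≤ R`
local in its cell, window system (`Λ`, `win`, every cell in its own window, at most `Nstar` windows
around a cell), nonnegative influence array `k` with the window contraction (H1), and the ratio
`γ₀ ∈ [0, 1)` of the received-sum condition (H2). Exactly the hypotheses of the tree's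
`DobrushinShlosman.abs_covariance_le` that concern `γ` (the remaining ones concern the observables
and the profile). A `structure` carrying data; nothing asserts that one exists for any given `γ`. -/
structure Certificate (γ : Specification V S) (cell : V → ι) where
  /-- the cell weight `w x σ τ` (LGT: `r(σ_x, τ_x)`) -/
  w : ι → (V → S) → (V → S) → ℝ
  /-- the uniform bound of the weight -/
  R : ℝ
  /-- window site sets -/
  Λ : ι → Finset V
  /-- window cell sets -/
  win : ι → Finset ι
  /-- bound on the number of windows around a cell -/
  Nstar : ℕ
  /-- the influence array `k c y x`: centre `c`, boundary cell `y`, interior cell `x` -/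
  k : ι → ι → ι → ℝ
  /-- the received-sum ratio -/
  γ₀ : ℝ
  /-- `0 ≤ R` -/
  R_nonneg : 0 ≤ R
  /-- `w ≤ R` -/
  w_le : ∀ c σ τ, w c σ τ ≤ R
  /-- the weight of the cell `c` reads the two configurations only on the cell `c` -/
  w_local : ∀ (c : ι) (σ σ' τ τ' : V → S), (∀ v, cell v = c → σ v = σ' v) →
    (∀ v, cell v = c → τ v = τ' v) → w c σ τ = w c σ' τ'
  /-- `Λ c` is the set of sites whose cell lies in `win c` -/
  mem_iff : ∀ c v, v ∈ Λ c ↔ cell v ∈ win c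
  /-- every cell lies in its own window -/
  self_mem : ∀ x, x ∈ win x
  /-- at most `Nstar` windows around any cell -/
  card_le : ∀ x, (Finset.univ.filter fun c => x ∈ win c).card ≤ Nstar
  /-- the influence array is nonnegative -/
  k_nonneg : ∀ c y x, 0 ≤ k c y x
  /-- (H1): one-boundary-cell vector Kantorovich contraction of every window kernel -/
  contract : IsWindowKRContraction γ cell w Λ win k
  /-- `0 ≤ γ₀` -/
  γ₀_nonneg : 0 ≤ γ₀
  /-- `γ₀ < 1` -/
  γ₀_lt_one : γ₀ < 1
  /-- (H2): the averaged received-sum condition with ratio `γ₀` -/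
  receivedSum : IsDSReceivedSum win k γ₀

namespace Certificate

variable {γ : Specification V S} {cell : V → ι}

/-- **The clustering rate per profile step delivered by a certificate**,
`κ₁ = (1 − γ₀)² / (2(2γ₀N⋆ + 1))` (the exponent of `DobrushinShlosman.abs_covariance_le`). -/
def rate (C : Certificate γ cell) : ℝ :=
  (1 - C.γ₀) ^ 2 / (2 * (2 * C.γ₀ * C.Nstar + 1))

/-- The rate of a certificate is positive (`γ₀ < 1`). -/
theorem rate_pos (C : Certificate γ cell) : 0 < C.rate := by
  have h1 : 0 < 1 - C.γ₀ := sub_pos.2 C.γ₀_lt_one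
  have h2 : 0 ≤ C.γ₀ := C.γ₀_nonneg
  unfold rate
  positivity

/-- **An admissible observable for the certificate `C`**: `f` is bounded and measurable, reads only
the cells `Δ`, and has the nonnegative cell-Lipschitz vector `δ` for the certificate's weight
(`|f σ − f τ| ≤ δ x · w x σ τ` whenever `σ = τ` off the cell `x`) — the observable-side hypotheses
of `DobrushinShlosman.abs_covariance_le` (LGT with the Frobenius weight: Lipschitz cylinder
functions of the links in `Δ`). -/
structure Obs (C : Certificate γ cell) (f : (V → S) → ℝ) (Δ : Finset ι) (δ : ι → ℝ) : Prop where
  /-- `f` is measurable -/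
  measurable : Measurable f
  /-- `f` is bounded -/
  bounded : ∃ B, ∀ σ, |f σ| ≤ B
  /-- `f` reads only the cells of `Δ` -/
  dependsOn : DependsOn f {v | cell v ∈ Δ}
  /-- the cell-Lipschitz vector is nonnegative -/
  nonneg : ∀ x, 0 ≤ δ x
  /-- `δ x` bounds the variation of `f` under a change of the cell `x`, in units of the weight -/
  lip : ∀ (x : ι) (σ τ : V → S), (∀ v, cell v ≠ x → σ v = τ v) → |f σ - f τ| ≤ δ x * C.w x σ τ

/-- **A profile adapted to the certificate `C` and the cell sets `Δf, Δg` at depth `L₀`**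
(`ℓ : ι → ℕ`, the layer function of the Dobrushin–Shlosman iteration; single-site LGT: the periodic
sup-distance to `Δg`, `exists_linkProfile`): windows around cells of positive profile avoid `Δg`;
`ℓ` drops by at most one from an interior cell `x ∈ win c` to a cell `y` influencing it
(`k c y x ≠ 0`); `ℓ ≥ L₀` on `Δf`. For windows of plaquette-diameter `D`, `⌊dist(·, Δg)/(D+1)⌋`
qualifies with `L₀ ≈ dist(Δf, Δg)/(D+1)`. -/
structure Profile (C : Certificate γ cell) (Δf Δg : Finset ι) (ℓ : ι → ℕ) (L₀ : ℕ) : Prop where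
  /-- windows around cells of positive profile avoid `Δg` -/
  avoid : ∀ x, ℓ x ≠ 0 → ∀ c, x ∈ C.win c → ∀ z ∈ C.win c, z ∉ Δg
  /-- one step of influence lowers the profile by at most one -/
  step : ∀ c x y, x ∈ C.win c → C.k c y x ≠ 0 → ℓ x ≤ ℓ y + 1
  /-- the profile is at least `L₀` on `Δf` -/
  le_on : ∀ x ∈ Δf, L₀ ≤ ℓ x

/-- **THE DOOR (proved in the tree, repackaged): a window certificate gives covariance decay for
every Gibbs measure.** For a certificate `C` of the specification `γ`, a Gibbs measure `ν`,
admissible observables `f, g` on the cells `Δf, Δg` with cell-Lipschitz vectors `δf, δg`, and an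
adapted profile at depth `L₀`:
`|cov_ν(f, g)| ≤ 4 R² e^{−κ₁ L₀} (Σ_{Δf} δf)(Σ_{Δg} δg)`, `κ₁ = C.rate = (1 − γ₀)²/(2(2γ₀N⋆ + 1))`.
This is `DobrushinShlosman.abs_covariance_le` (Dobrushin–Shlosman 1985; Föllmer 1988 Ch. I Thm.
(2.13); Künsch 1982; Georgii 2011 §8.2) with its specification-side hypotheses read from `C`. -/
theorem abs_covariance_le [DecidableEq V] (C : Certificate γ cell) (hγ : IsSpecification γ)
    {ν : Measure (V → S)} (hν : IsGibbsMeasure γ ν) {f g : (V → S) → ℝ} {Δf Δg : Finset ι}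
    {δf δg : ι → ℝ} (hf : C.Obs f Δf δf) (hg : C.Obs g Δg δg) {ℓ : ι → ℕ} {L₀ : ℕ}
    (hℓ : C.Profile Δf Δg ℓ L₀) :
    |cov[f, g; ν]| ≤ 4 * C.R ^ 2 * Real.exp (-(C.rate * L₀)) *
      (∑ x ∈ Δf, δf x) * ∑ y ∈ Δg, δg y := by
  obtain ⟨Bf, hBf⟩ := hf.bounded
  obtain ⟨Bg, hBg⟩ := hg.bounded
  exact DobrushinShlosman.abs_covariance_le C.R_nonneg C.w_le C.w_local hγ C.mem_iff C.k_nonneg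
    C.contract C.γ₀_nonneg C.γ₀_lt_one C.receivedSum C.card_le C.self_mem hν hf.measurable
    hg.measurable hBf hBg hf.dependsOn hg.dependsOn hf.nonneg hf.lip hg.nonneg hg.lip ℓ L₀
    hℓ.avoid hℓ.step hℓ.le_on

end Certificate

end Abstract

/-! ### Sanity: the single-site Dobrushin condition is the certificate of the window system `{x}` -/

section SingleSite

variable {V S : Type*} [MeasurableSpace S] [DecidableEq V]

/-- **The single-site window system satisfies (H1) with the Dobrushin coefficients.** If the
one-site laws of `γ` form a Kantorovich–Rubinstein contraction with weight `r`, neighbourhoods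
`nbr` and coefficients `C` (the tree's `DobrushinMetric.IsKRContraction`, Föllmer 1988 Ch. I
(2.20)), then the windows `Λ x = win x = {x}` (cells = sites) satisfy (H1) with the array
`k c y x = C c y` for `x = c`, `y ∈ nbr c`, and `0` otherwise: a window-local test function is a
function of the single spin, and the window kernel integrates it against the one-site law. -/
theorem isWindowKRContraction_singleSite {γ : Specification V S} (hγ : IsSpecification γ)
    {r : S → S → ℝ} {nbr : V → Finset V} {C : V → V → ℝ} (hC : IsKRContraction γ r nbr C) :
    IsWindowKRContraction γ id (fun x σ τ => r (σ x) (τ x)) (fun c => {c}) (fun c => {c})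
      (fun c y x => if x = c ∧ y ∈ nbr c then C c y else 0) := by
  intro c y hy ω η hωη f δ hfm hfb hfdep hδ0 hδ
  rw [Finset.sum_singleton]
  simp only [true_and]
  -- the test function of the single spin at `c`
  set φ : S → ℝ := fun s => f (Function.update ω c s) with hφ
  have hφη : ∀ s, f (Function.update η c s) = φ s := fun s =>
    hfdep fun v hv => by
      have hvc : v = c := by simpa using hv
      subst hvc
      simp
  have h1 : ∫ σ, f σ ∂(γ {c} ω) = ∫ s, φ s ∂(siteLaw γ c ω) :=
    siteAvg_eq_integral_siteLaw hγ c hfm ω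
  have h2 : ∫ σ, f σ ∂(γ {c} η) = ∫ s, φ s ∂(siteLaw γ c η) := by
    have h := siteAvg_eq_integral_siteLaw hγ c hfm η
    simp only [hφη] at h
    exact h
  have hφm : Measurable φ := hfm.comp (measurable_update ω)
  have hφb : ∃ M, ∀ s, |φ s| ≤ M := hfb.imp fun B hB s => hB _
  have hφL : ∀ a b, |φ a - φ b| ≤ δ c * r a b := fun a b => by
    have h := hδ c (Function.update ω c a) (Function.update ω c b) fun v (hv : v ≠ c) => by
      rw [Function.update_of_ne hv, Function.update_of_ne hv]
    simpa using h
  rw [h1, h2]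
  by_cases hyn : y ∈ nbr c
  · rw [if_pos hyn]
    have h := hC.contract c y hyn ω η (fun z hz => hωη z hz) φ (δ c) hφm hφb (hδ0 c) hφL
    simpa [mul_assoc] using h
  · rw [if_neg hyn, zero_mul, zero_mul]
    have hlaw : siteLaw γ c ω = siteLaw γ c η :=
      hC.siteLaw_congr c ω η fun z hz => hωη z fun hzy => hyn (hzy ▸ hz)
    rw [hlaw, sub_self, abs_zero]

variable [Fintype V]

/-- The windows containing `x` in the single-site window system are `{x}`. -/
theorem filter_mem_singleton_eq (x : V) :
    (Finset.univ.filter fun c : V => x ∈ ({c} : Finset V)) = {x} := by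
  ext c
  simp [Finset.mem_singleton, eq_comm]

/-- **The single-site window system satisfies (H2) with `γ₀ =` the Dobrushin row-sum bound**:
`Σ_{c ∋ x} Σ_y k c y x = Σ_{y ∈ nbr x} C x y ≤ c = c · #{c ∋ x}`. -/
theorem isDSReceivedSum_singleSite {nbr : V → Finset V} {C : V → V → ℝ} {c : ℝ}
    (hrow : ∀ x, ∑ y ∈ nbr x, C x y ≤ c) :
    IsDSReceivedSum (fun x => ({x} : Finset V))
      (fun c' y x => if x = c' ∧ y ∈ nbr c' then C c' y else 0) c := by
  intro x
  rw [filter_mem_singleton_eq, Finset.sum_singleton, Finset.card_singleton, Nat.cast_one, mul_one]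
  simp only [true_and]
  rw [Finset.sum_ite_mem, Finset.univ_inter]
  exact hrow x

/-- **SANITY — the window door contains the single-site door.** Dobrushin's condition in the
Vasserstein form for the one-site laws of `γ` (`DobrushinMetric.IsKRContraction γ r nbr C` with a
bounded weight `r ≤ R` and row sums `Σ_{y ∈ nbr x} C x y ≤ c < 1` — for `SU(N)` lattice Yang–Mills
the hypothesis shape of the tree's `shen_zhu_zhu_of_dobrushinCondition` / `isKRContraction_torusWilson`,
i.e. the single-link front) IS a Dobrushin–Shlosman window certificate: windows `{x}`, `N⋆ = 1`,
`γ₀ = c`, weight `w x σ τ = r(σ_x, τ_x)`. -/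
def Certificate.ofKRContraction {γ : Specification V S} (hγ : IsSpecification γ)
    {r : S → S → ℝ} {nbr : V → Finset V} {C : V → V → ℝ} (hC : IsKRContraction γ r nbr C)
    {R c : ℝ} (hR : 0 ≤ R) (hrR : ∀ a b, r a b ≤ R) (hc0 : 0 ≤ c) (hc1 : c < 1)
    (hrow : ∀ x, ∑ y ∈ nbr x, C x y ≤ c) : Certificate γ (id : V → V) where
  w x σ τ := r (σ x) (τ x)
  R := R
  Λ c := {c}
  win c := {c}
  Nstar := 1
  k c y x := if x = c ∧ y ∈ nbr c then C c y else 0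
  γ₀ := c
  R_nonneg := hR
  w_le _ _ _ := hrR _ _
  w_local c σ σ' τ τ' hσ hτ := by simp only [hσ c rfl, hτ c rfl]
  mem_iff _ _ := Iff.rfl
  self_mem x := Finset.mem_singleton_self x
  card_le x := by rw [filter_mem_singleton_eq, Finset.card_singleton]
  k_nonneg c y x := by
    split_ifs
    · exact hC.nonneg c y
    · exact le_rfl
  contract := isWindowKRContraction_singleSite hγ hC
  γ₀_nonneg := hc0
  γ₀_lt_one := hc1
  receivedSum := isDSReceivedSum_singleSite hrow

end SingleSite

end Summit.Ventures.YMGap.DSWindow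

end
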